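import Literature.NumberTheory.LFunctions.DedekindZeta1LogFreeMiddleRangeDegreeThree
import HarnessLib

/-!
# The log-free zero-density estimate for `ζ_K` in degree `n ≤ 3` (Bombieri's Théorème 14 for `ζ₁_K`,
# uniformly in the field)

Topic `Literature/NumberTheory/LFunctions`, namespace `Literature.NumberTheory.LFunctions.NumberField`.
Everything here is PROVED (theorems only; no definitions, no named facts).

The sibling `DedekindZeta1LogFreeTheorem14.lean` proves `logFreeDensity_dedekindZeta₁` — the log-free zero-density
estimate for the zeros of `ζ_K` (= of the entire `ζ₁_K(s) = (s − 1)ζ_K(s)`), with a size parameter `P ≥ 2` dominating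
`|d_K|`, `h_K`, `1/κ_K` and the heights — for number fields of degree `n ≤ 2`.  The degree restriction came only from
Lemme B for `ζ₁_K` (the pole's share of the Lemme-A lower bound).  With the sharp pole bookkeeping of
`DedekindZeta1LogFreeLemmaBDegreeThree.lean` (slack `(4/3) n_K ≤ 4` for `n_K ≤ 3`) and the middle range
`middleRange_Z1_of_finrank_le_three`, the assembly with the small range (`smallRange_Z1`, Landau–Page: at most one
zero, simple) and the trivial range (`largeRange_Z1`, `n_K ≤ 4`) is verbatim that of the sibling:

* `logFreeDensity_dedekindZeta₁_of_le_three` — **for every degree `n ≤ 3` there are `c_D, C_D > 0` such that for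
  every number field `K` of degree `n`, every `P ≥ 2` with `|d_K| ≤ P`, `h_K ≤ P`, `κ_K ≥ 1/P`, every finite set
  `Z` of zeros of `ζ_K` with `1/4 ≤ β < 1`, `|γ| ≤ P`, and all `0 ≤ α ≤ 1`:
  `Σ_{ρ ∈ Z, β ≥ α} m(ρ) ≤ C_D P^{c_D(1−α)}`** — EXACTLY the shape of `logFreeDensity_dedekindZeta₁ n (n ≤ 2)`.

In print this is the `χ = 1` member of the log-free zero-density estimate for the Hecke `L`-functions of the Hilbert
class field of `K` (Weiss 1983, Thm. 4.3; Thorner–Zaman 2019, Thm. 3.2 — the bound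
`Σ_χ N(σ,T,χ) ≪ (QT^{n_K})^{c(1−σ)}` "regardless of whether `β₁` exists", i.e. WITHOUT the Deuring–Heilbronn factor
`B₁`), now available in the tree for cubic fields; together with `logFreeDensity_classGroup 3` (the `χ ≠ 1` members,
`ClassGroupLogFreeTheorem14.lean`) it is the complete zero-density input of a Linnik-type prime ideal theorem for the
ideal classes of a cubic field.  What is NOT here: degree `n ≥ 4` for `ζ_K` (needs the abstract Lemme B with slack
`η ≤ 8`), and the Deuring–Heilbronn enhancement.

## References

* [Bombieri1987GrandCrible] E. Bombieri, Astérisque 18 (1987), §6 Théorème 14 (the case of `ζ`).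
* [ThornerZaman2017] J. Thorner, A. Zaman, Algebra Number Theory 11 (2017), §5 (Theorem 5.3).
* [ThornerZaman2019] J. Thorner, A. Zaman, *A unified and improved Chebotarev density theorem*, Algebra Number
  Theory 13 (2019) 1039–1068, Thm. 3.2 (arXiv:1803.02823, §3).
* [Weiss1983] A. Weiss, *The least prime ideal*, J. reine angew. Math. 338 (1983) 56–94, Thm. 4.3.
-/

noncomputable section

open Complex Finset Filter Real MeasureTheory
open scoped LSeries.notation ArithmeticFunction.vonMangoldt Topology Nat

namespace Literature.NumberTheory.LFunctions.NumberField

open Literature.NumberTheory.LFunctions.LogFreeLocal Literature.NumberTheory.LFunctions.LogFreeDensity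
  Literature.NumberTheory.LFunctions.AbelianDensity
open scoped nonZeroDivisors _root_.NumberField

open scoped Classical in
/-- **The log-free zero-density estimate for `ζ_K`, degree `n ≤ 3`** (Bombieri's Théorème 14 for the
trivial class group character; Thorner–Zaman 2017 Theorem 5.3 with `δ(χ) = 1`; the `χ = 1`, `B₁ = 1` case of
Thorner–Zaman 2019 Theorem 3.2 for the Hilbert class field of a field of degree `≤ 3`): there are `c_D, C_D > 0`
such that for every number field `K` of degree `n`, every `P ≥ 2` with `|d_K| ≤ P`, `h_K ≤ P`, `κ_K ≥ 1/P`, every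
finite set `Z` of zeros of `ζ_K` with `1/4 ≤ β < 1`, `|γ| ≤ P`, and all `0 ≤ α ≤ 1`:
`Σ_{ρ ∈ Z, β ≥ α} m(ρ) ≤ C_D P^{c_D(1−α)}`. [cite: ThornerZaman2019, Thm. 3.2] -/
theorem logFreeDensity_dedekindZeta₁_of_le_three (n : ℕ) (hn : n ≤ 3) :
    ∃ c_D C_D : ℝ, 0 < c_D ∧ 0 < C_D ∧
      ∀ (K : Type) [Field K] [NumberField K], Module.finrank ℚ K = n →
        ∀ P : ℝ, 2 ≤ P → ((NumberField.discr K).natAbs : ℝ) ≤ P →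
          (Fintype.card (ClassGroup (𝓞 K)) : ℝ) ≤ P → P⁻¹ ≤ NumberField.dedekindZeta_residue K →
        ∀ Z : Finset ℂ, (∀ ρ ∈ Z, dedekindZeta₁ K ρ = 0 ∧ 1 / 4 ≤ ρ.re ∧ ρ.re < 1 ∧ |ρ.im| ≤ P) →
          ∀ α : ℝ, 0 ≤ α → α ≤ 1 →
            ∑ ρ ∈ Z with α ≤ ρ.re, (zeroOrder (dedekindZeta₁ K) ρ : ℝ) ≤ C_D * P ^ (c_D * (1 - α)) := by
  obtain ⟨c₁, hc₁, hsmall⟩ := smallRange_Z1 n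
  obtain ⟨δ₀, A, C, hδ₀, hA, hC, hmid⟩ := middleRange_Z1_of_finrank_le_three hc₁
  obtain ⟨C₃, hC₃, hlarge⟩ := largeRange_Z1
  refine ⟨max A (2 / δ₀), max (max 1 C) C₃, by positivity, by positivity,
    fun K _ _ hK P hP hd hh hκ Z hZ α hα0 hα1 => ?_⟩
  have hnK : Module.finrank ℚ K ≤ 3 := hK ▸ hn
  have hnK4 : Module.finrank ℚ K ≤ 4 := hnK.trans (by norm_num)
  have hP1 : 1 ≤ P := by linarith
  have hexp0 : 0 ≤ max A (2 / δ₀) * (1 - α) := mul_nonneg (by positivity) (by linarith)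
  have hPpow1 : 1 ≤ P ^ (max A (2 / δ₀) * (1 - α)) := Real.one_le_rpow hP1 hexp0
  rcases lt_or_ge (1 - α) (c₁ / Real.log P) with h1 | h1
  · refine (hsmall K hK P hP hd Z (fun ρ hρ ↦ ⟨(hZ ρ hρ).1, (hZ ρ hρ).2.2.2⟩) α h1).trans ?_
    calc (1 : ℝ) ≤ max (max 1 C) C₃ * 1 := by
          have : (1:ℝ) ≤ max (max 1 C) C₃ := (le_max_left _ _).trans' (le_max_left _ _)
          linarith
      _ ≤ _ := mul_le_mul_of_nonneg_left hPpow1 (by positivity)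
  rcases le_or_gt (1 - α) δ₀ with h2 | h2
  · refine (hmid K hnK P hP hd hh hκ Z (fun ρ hρ ↦ ?_) α h1 h2).trans ?_
    · obtain ⟨h0, hβ, hβ1, him⟩ := hZ ρ hρ
      exact ⟨h0, by linarith, hβ1, him⟩
    refine mul_le_mul ((le_max_right _ _).trans (le_max_left _ _)) ?_ (by positivity) (by positivity)
    exact Real.rpow_le_rpow_of_exponent_le hP1 (mul_le_mul_of_nonneg_right (le_max_left _ _) (by linarith))
  · have hsub : ∑ ρ ∈ Z with α ≤ ρ.re, (zeroOrder (dedekindZeta₁ K) ρ : ℝ) ≤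
        ∑ ρ ∈ Z, (zeroOrder (dedekindZeta₁ K) ρ : ℝ) :=
      sum_le_sum_of_subset_of_nonneg (filter_subset _ _) fun ρ _ _ => Nat.cast_nonneg _
    refine hsub.trans ((hlarge K hnK4 P hP hd Z (fun ρ hρ ↦ ?_)).trans ?_)
    · obtain ⟨h0, hβ, hβ1, him⟩ := hZ ρ hρ
      exact ⟨h0, hβ, hβ1.le, him⟩
    refine mul_le_mul (le_max_right _ _) ?_ (by positivity) (by positivity)
    rw [← Real.rpow_natCast]
    refine Real.rpow_le_rpow_of_exponent_le hP1 ?_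
    push_cast
    have : (2 : ℝ) ≤ 2 / δ₀ * (1 - α) := by
      rw [div_mul_eq_mul_div, le_div_iff₀ hδ₀]; nlinarith
    exact this.trans (mul_le_mul_of_nonneg_right (le_max_right _ _) (by linarith))

open scoped Classical in
/-- **The log-free zero-density estimate for `ζ_K` of a CUBIC field** (the case `n = 3` of
`logFreeDensity_dedekindZeta₁_of_le_three`, recorded under its own name for the consumers of the cubic slice).
[cite: ThornerZaman2019, Thm. 3.2] -/
theorem logFreeDensity_dedekindZeta₁_three :
    ∃ c_D C_D : ℝ, 0 < c_D ∧ 0 < C_D ∧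
      ∀ (K : Type) [Field K] [NumberField K], Module.finrank ℚ K = 3 →
        ∀ P : ℝ, 2 ≤ P → ((NumberField.discr K).natAbs : ℝ) ≤ P →
          (Fintype.card (ClassGroup (𝓞 K)) : ℝ) ≤ P → P⁻¹ ≤ NumberField.dedekindZeta_residue K →
        ∀ Z : Finset ℂ, (∀ ρ ∈ Z, dedekindZeta₁ K ρ = 0 ∧ 1 / 4 ≤ ρ.re ∧ ρ.re < 1 ∧ |ρ.im| ≤ P) →
          ∀ α : ℝ, 0 ≤ α → α ≤ 1 →
            ∑ ρ ∈ Z with α ≤ ρ.re, (zeroOrder (dedekindZeta₁ K) ρ : ℝ) ≤ C_D * P ^ (c_D * (1 - α)) :=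
  logFreeDensity_dedekindZeta₁_of_le_three 3 le_rfl

end Literature.NumberTheory.LFunctions.NumberField

end
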